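import Literature.NumberTheory.QuadraticForms.LandherrHermitianRealisation
import HarnessLib

/-!
# Hyperbolic splitting (Witt index) of hermitian forms over a CM field (Landherr)

Topic `NumberTheory/QuadraticForms`.  Let `L` be a CM field with complex conjugation `σ`, and let
`⟨a⟩ = ∑ aᵢ xᵢ σ(yᵢ)` be a non-degenerate diagonal hermitian form of rank `n = 2m + k` (`aᵢ ∈ L⁺ˣ`).  The
**hyperbolic model** `Landherr.hypModel m d = 𝐇^m ⊥ ⟨d⟩` is the diagonal form `⟨1, …, 1, -1, …, -1, d₁, …, d_k⟩`
(`m` ones, `m` minus-ones): `m` hyperbolic planes `⟨1, -1⟩` and a rank-`k` complement.  By Landherr's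
classification (`hermitianDiagonal_isometric_iff_invariants`) and the realisation of prescribed invariants
(`Landherr.exists_hermitianDiagonal_of_invariants`, Deligne LNM 900 Prop. 4.1) one reads off exactly when `⟨a⟩`
splits off `m` hyperbolic planes:

* `Landherr.isometric_hypModel_iff` — `⟨a⟩ ≅ 𝐇^m ⊥ ⟨d⟩` for some non-degenerate `⟨d⟩` of rank `k` **iff**
  `m ≤ p_τ ≤ m + k` at every complex embedding `τ` (`p_τ` the positive index, i.e. `m ≤ min (p_τ, n - p_τ)`), and,
  when `k = 0`, `∏ aᵢ ≡ (-1)^m` in `L⁺ˣ / N(Lˣ)`.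

So the Witt index of a hermitian space over a CM field is `min_τ min (p_τ, q_τ)`, except that in the extreme case
`p_τ = q_τ = n/2` for all `τ` the last plane splits off iff the discriminant is `(-1)^{n/2}` modulo norms (the case
`k = 0` is Cattani–El Zein–Griffiths–Lê (eds.), *Hodge Theory*, Cor. 11.5.14 p. 506: "split" hermitian forms) — the
global form of the facts that hermitian spaces of dimension `≥ 3` over a non-archimedean quadratic extension are
isotropic and that the anisotropic binary ones are detected by the discriminant (Shimura 2008 Lemma 1.6, §1.4 "core
dimension"; Scharlau Ch. 10 §1).  The case `m = 1`, `k ≥ 1` recovers the isotropy criterion of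
`LandherrHermitianIsotropy.lean` in its "splits a hyperbolic plane" form.

Provenance: `pub-hodgecm` Landherr lineage, gen 19 (new material; not a port of a package file).

## References

* W. Landherr, *Äquivalenz Hermitescher Formen über einem beliebigen algebraischen Zahlkörper*, Abh. Math. Sem.
  Hamburg 11 (1936) 245–248 [Landherr1936HermitianForms].
* G. Shimura, *Arithmetic of hermitian forms*, Doc. Math. 13 (2008) 739–774, §1.4, Lemma 1.6, Theorem 2.2,
  doi:10.4171/dm/258.
* P. Deligne, *Hodge cycles on abelian varieties*, LNM 900 (1982), §4 Prop. 4.1 p. 44 [Deligne1982HodgeCycles].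
* W. Scharlau, *Quadratic and Hermitian Forms*, Grundlehren 270 (1985), Ch. 10 §1 [Scharlau1985HermitianForms].
* E. Cattani, F. El Zein, P. A. Griffiths, Lê D. T. (eds.), *Hodge Theory*, Princeton Math. Notes 49 (2014),
  Thm. 11.5.13 (Landherr) and Cor. 11.5.14 (split forms), pp. 506–507, isbn 9780691161341.
-/

noncomputable section

open NumberField NumberField.InfinitePlace
open scoped Matrix

namespace Literature.NumberTheory.QuadraticForms

namespace Landherr

section Model

variable (L : Type) [Field L] [NumberField L] [IsCMField L]

/-- The **hyperbolic model** `𝐇^m ⊥ ⟨d⟩ = ⟨1,…,1,-1,…,-1,d₁,…,d_k⟩` (`m` ones, `m` minus-ones). [folklore] -/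
def hypModel (m : ℕ) {k : ℕ} (d : Fin k → L) : Fin (m + m + k) → L :=
  Fin.append (Fin.append (fun _ : Fin m => (1 : L)) (fun _ : Fin m => (-1 : L))) d

omit [NumberField L] [IsCMField L] in
/-- The first `m` entries of the model are `1`. [folklore] -/
@[simp] theorem hypModel_left_left (m : ℕ) {k : ℕ} (d : Fin k → L) (i : Fin m) :
    hypModel L m d (Fin.castAdd k (Fin.castAdd m i)) = 1 := by
  simp [hypModel]

omit [NumberField L] [IsCMField L] in
/-- The next `m` entries of the model are `-1`. [folklore] -/
theorem hypModel_left_right (m : ℕ) {k : ℕ} (d : Fin k → L) (i : Fin m) :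
    hypModel L m d (Fin.castAdd k (Fin.natAdd m i)) = -1 := by
  unfold hypModel
  rw [Fin.append_left, Fin.append_right]

omit [NumberField L] [IsCMField L] in
/-- The same with `Fin.addNat` (the `simp`-normal form of `Fin.natAdd m i` for `i : Fin m`). [folklore] -/
@[simp] theorem hypModel_left_right' (m : ℕ) {k : ℕ} (d : Fin k → L) (i : Fin m) :
    hypModel L m d (Fin.castAdd k (i.addNat m)) = -1 := by
  rw [← Fin.natAdd_eq_addNat]
  exact hypModel_left_right L m d i

omit [NumberField L] [IsCMField L] in
/-- The last `k` entries of the model are `d`. [folklore] -/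
@[simp] theorem hypModel_right (m : ℕ) {k : ℕ} (d : Fin k → L) (i : Fin k) :
    hypModel L m d (Fin.natAdd (m + m) i) = d i := by
  simp [hypModel]

/-- The entries of the model are `σ`-fixed when those of `d` are. [folklore] -/
theorem hypModel_isReal (m : ℕ) {k : ℕ} {d : Fin k → L} (hd : ∀ i, IsCMField.complexConj L (d i) = d i) (i) :
    IsCMField.complexConj L (hypModel L m d i) = hypModel L m d i := by
  induction i using Fin.addCases with
  | left i =>
    induction i using Fin.addCases with
    | left i => simp
    | right i => simp
  | right i => simpa using hd i

omit [NumberField L] [IsCMField L] in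
/-- The entries of the model are non-zero when those of `d` are. [folklore] -/
theorem hypModel_ne_zero (m : ℕ) {k : ℕ} {d : Fin k → L} (hd0 : ∀ i, d i ≠ 0) (i) : hypModel L m d i ≠ 0 := by
  induction i using Fin.addCases with
  | left i =>
    induction i using Fin.addCases with
    | left i => simp
    | right i => simp
  | right i => simpa using hd0 i

omit [IsCMField L] in
/-- Positive index of the model: `p_τ(𝐇^m ⊥ ⟨d⟩) = m + p_τ(d)`. [folklore] -/
theorem posCount_hypModel (τ : L →+* ℂ) (m : ℕ) {k : ℕ} (d : Fin k → L) :
    posCount L τ (hypModel L m d) = m + posCount L τ d := by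
  rw [posCount_eq_sum, posCount_eq_sum, Fin.sum_univ_add, Fin.sum_univ_add]
  simp

omit [NumberField L] [IsCMField L] in
/-- Discriminant of the model: `∏ (𝐇^m ⊥ ⟨d⟩) = (-1)^m ∏ dᵢ`. [folklore] -/
theorem prod_hypModel (m : ℕ) {k : ℕ} (d : Fin k → L) : ∏ i, hypModel L m d i = (-1) ^ m * ∏ i, d i := by
  rw [Fin.prod_univ_add, Fin.prod_univ_add]
  simp

end Model

section Arith

/-- Sign bookkeeping: for a non-zero real `x`, `0 < (-1)^m x` iff (`m` even ↔ `x > 0`). [folklore] -/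
theorem neg_one_pow_mul_pos_iff (m : ℕ) {x : ℝ} (hx : x ≠ 0) : 0 < (-1 : ℝ) ^ m * x ↔ (Even m ↔ 0 < x) := by
  rcases Nat.even_or_odd m with hm | hm
  · rw [hm.neg_one_pow, one_mul]
    exact ⟨fun h => ⟨fun _ => h, fun _ => hm⟩, fun h => h.1 hm⟩
  · rw [hm.neg_one_pow, neg_one_mul, neg_pos]
    constructor
    · intro h
      exact ⟨fun hm' => absurd hm (Nat.not_odd_iff_even.mpr hm'), fun h' => absurd h (not_lt.mpr h'.le)⟩
    · intro h
      exact lt_of_le_of_ne (not_lt.mp fun h' => (Nat.not_even_iff_odd.mpr hm) (h.mpr h')) hx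

end Arith

section Binary

variable (L : Type) [Field L] [NumberField L] [IsCMField L]

omit [NumberField L] [IsCMField L] in
/-- `x σ(x) = 0` forces `x = 0` (`σ` any ring endomorphism of a field). [folklore] -/
theorem eq_zero_of_mul_map_self_eq_zero (σ : L →+* L) {x : L} (h : x * σ x = 0) : x = 0 := by
  rcases mul_eq_zero.mp h with h | h
  · exact h
  · exact (map_eq_zero σ).mp h

/-- **Binary hermitian forms: isotropy.**  A non-degenerate binary hermitian form `⟨a₀, a₁⟩` over the CM field `L`
represents zero non-trivially iff `-a₀/a₁` is a norm `z σ(z)` from `L` (the rank-2 complement of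
`LandherrHermitianIsotropy.lean`, which treats rank `≥ 3`; elementary, valid for any quadratic extension).
[cite: Landherr1936HermitianForms] -/
theorem binary_isotropic_iff (a : Fin 2 → L) (ha0 : ∀ i, a i ≠ 0) :
    (∃ v : Fin 2 → L, v ≠ 0 ∧ ∑ i, a i * (v i * IsCMField.complexConj L (v i)) = 0) ↔
      ∃ z : L, -(a 0 / a 1) = z * IsCMField.complexConj L z := by
  set σ := IsCMField.complexConj L with hσ
  constructor
  · rintro ⟨v, hv, hsum⟩
    rw [Fin.sum_univ_two] at hsum
    -- both coordinates are non-zero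
    have hv0 : v 0 ≠ 0 := by
      intro h0
      have h1 : v 1 = 0 := by
        have : a 1 * (v 1 * σ (v 1)) = 0 := by simpa [h0] using hsum
        exact eq_zero_of_mul_map_self_eq_zero L σ ((mul_eq_zero.mp this).resolve_left (ha0 1))
      exact hv (funext fun i => by fin_cases i <;> assumption)
    have hv1 : v 1 ≠ 0 := by
      intro h1
      have h0 : v 0 = 0 := by
        have : a 0 * (v 0 * σ (v 0)) = 0 := by simpa [h1] using hsum
        exact eq_zero_of_mul_map_self_eq_zero L σ ((mul_eq_zero.mp this).resolve_left (ha0 0))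
      exact hv0 h0
    refine ⟨v 1 / v 0, ?_⟩
    have hσ0 : σ (v 0) ≠ 0 := fun h => hv0 ((map_eq_zero σ).mp h)
    rw [map_div₀, div_mul_div_comm, eq_div_iff (mul_ne_zero hv0 hσ0), neg_mul, div_mul_eq_mul_div,
      neg_eq_iff_eq_neg, div_eq_iff (ha0 1)]
    linear_combination hsum
  · rintro ⟨z, hz⟩
    refine ⟨![1, z], ?_, ?_⟩
    · intro h
      have := congr_fun h 0
      simp at this
    · rw [Fin.sum_univ_two]
      simp only [Matrix.cons_val_zero, Matrix.cons_val_one, map_one, mul_one]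
      rw [← hz]
      field_simp [ha0 1]
      ring

end Binary

section Witt

variable (L : Type) [Field L] [NumberField L] [IsCMField L]

/-- **Hyperbolic splitting (Witt index) of hermitian forms over a CM field.**  A non-degenerate diagonal hermitian
form `⟨a⟩` of rank `2m + k` over the CM field `L` is isometric to `𝐇^m ⊥ ⟨d⟩` for some non-degenerate diagonal
`⟨d⟩` of rank `k` (i.e. splits off `m` hyperbolic planes) if and only if `m ≤ p_τ ≤ m + k` for the positive index
`p_τ` at every complex embedding `τ`, and, when `k = 0`, `∏ aᵢ = (-1)^m · z σ(z)` for some `z ∈ Lˣ` (the case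
`k = 0`: Cattani et al. (eds.), *Hodge Theory*, Cor. 11.5.14 p. 506).
[cite: Landherr1936HermitianForms] -/
theorem isometric_hypModel_iff {m k : ℕ} (a : Fin (m + m + k) → L)
    (ha : ∀ i, IsCMField.complexConj L (a i) = a i) (ha0 : ∀ i, a i ≠ 0) :
    (∃ d : Fin k → L, (∀ i, IsCMField.complexConj L (d i) = d i) ∧ (∀ i, d i ≠ 0) ∧
        ∃ g : GL (Fin (m + m + k)) L,
          ((g : Matrix (Fin (m + m + k)) (Fin (m + m + k)) L).transpose.map (IsCMField.complexConj L)) *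
            Matrix.diagonal a * (g : Matrix (Fin (m + m + k)) (Fin (m + m + k)) L) =
              Matrix.diagonal (hypModel L m d)) ↔
      ((∀ τ : L →+* ℂ, m ≤ posCount L τ a ∧ posCount L τ a ≤ m + k) ∧
        (k = 0 → ∃ z : L, z ≠ 0 ∧ ∏ i, a i = (-1) ^ m * (z * IsCMField.complexConj L z))) := by
  constructor
  · rintro ⟨d, hd, hd0, g, hg⟩
    obtain ⟨hp, z, hz, hdisc⟩ := (hermitianDiagonal_isometric_iff_invariants L a (hypModel L m d) ha
      (hypModel_isReal L m hd) ha0 (hypModel_ne_zero L m hd0)).mp ⟨g, hg⟩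
    refine ⟨fun τ => ?_, fun hk => ⟨z, hz, ?_⟩⟩
    · have hpτ : posCount L τ a = posCount L τ (hypModel L m d) := hp τ
      rw [hpτ, posCount_hypModel]
      have := posCount_le_card L τ d
      rw [Fintype.card_fin] at this
      omega
    · subst hk
      rw [hdisc, prod_hypModel]
      simp
  · rintro ⟨hsig, hdisc⟩
    rcases Nat.eq_zero_or_pos k with hk | hk
    · -- no complement: `⟨a⟩ ≅ 𝐇^m`
      subst hk
      obtain ⟨z, hz, hz'⟩ := hdisc rfl
      refine ⟨Fin.elim0, fun i => i.elim0, fun i => i.elim0, ?_⟩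
      refine (hermitianDiagonal_isometric_iff_invariants L a (hypModel L m Fin.elim0) ha
        (hypModel_isReal L m fun i => i.elim0) ha0 (hypModel_ne_zero L m fun i => i.elim0)).mpr
        ⟨fun τ => ?_, z, hz, ?_⟩
      · show posCount L τ a = posCount L τ (hypModel L m Fin.elim0)
        rw [posCount_hypModel]
        have h1 := hsig τ
        have h2 : posCount L τ (Fin.elim0 : Fin 0 → L) = 0 :=
          le_antisymm ((posCount_le_card L τ _).trans (by simp)) (Nat.zero_le _)
        omega
      · rw [prod_hypModel, hz']
        simp
    · -- realise the complement `⟨d⟩` with `p_τ(d) = p_τ(a) - m` and `∏ d = (-1)^m ∏ a`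
      have hP : IsCMField.complexConj L (∏ i, a i) = ∏ i, a i := by
        rw [map_prod]; exact Finset.prod_congr rfl fun i _ => ha i
      have hP0 : ∏ i, a i ≠ 0 := Finset.prod_ne_zero_iff.mpr fun i _ => ha0 i
      have hf : IsCMField.complexConj L ((-1) ^ m * ∏ i, a i) = (-1) ^ m * ∏ i, a i := by
        rw [map_mul, map_pow, map_neg, map_one, hP]
      have hf0 : (-1 : L) ^ m * ∏ i, a i ≠ 0 := mul_ne_zero (pow_ne_zero m (neg_ne_zero.mpr one_ne_zero)) hP0
      have hsign : ∀ τ : L →+* ℂ, 0 < (τ ((-1) ^ m * ∏ i, a i)).re ↔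
          Even (k - (posCount L (InfinitePlace.mk τ).embedding a - m)) := by
        intro τ
        rw [posCount_embedding_mk]
        have hne : (τ (∏ i, a i)).re ≠ 0 := re_ne_zero_of_isReal hP hP0 τ
        have hre : (τ ((-1) ^ m * ∏ i, a i)).re = (-1 : ℝ) ^ m * (τ (∏ i, a i)).re := by
          rw [map_mul, map_pow, map_neg, map_one]
          rw [show ((-1 : ℂ) ^ m) = ((-1 : ℝ) ^ m : ℝ) by push_cast; ring, Complex.re_ofReal_mul]
        rw [hre, neg_one_pow_mul_pos_iff m hne, re_prod_pos_iff L ha ha0 τ, Fintype.card_fin]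
        obtain ⟨h1, h2⟩ := hsig τ
        rw [show m + m + k - posCount L τ a = (k - (posCount L τ a - m)) + m by omega, Nat.even_add]
        tauto
      obtain ⟨d, hd, hd0, hdp, hdprod⟩ := exists_hermitianDiagonal_of_invariants L hk
        (fun w => posCount L w.embedding a - m)
        (fun w => by
          obtain ⟨h1, h2⟩ := hsig w.embedding
          omega)
        hf hf0 hsign
      refine ⟨d, hd, hd0, (hermitianDiagonal_isometric_iff_invariants L a (hypModel L m d) ha
        (hypModel_isReal L m hd) ha0 (hypModel_ne_zero L m hd0)).mpr ⟨fun τ => ?_, 1, one_ne_zero, ?_⟩⟩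
      · show posCount L τ a = posCount L τ (hypModel L m d)
        rw [posCount_hypModel, hdp τ, posCount_embedding_mk]
        have := (hsig τ).1
        omega
      · rw [prod_hypModel, hdprod, map_one, mul_one, mul_one, ← mul_assoc, ← pow_add,
          Even.neg_one_pow ⟨m, rfl⟩, one_mul]

/-- **Witt index ≥ 1 = isotropy, in splitting form.**  With `k ≥ 1`: `⟨a⟩` of rank `2 + k` splits off a hyperbolic
plane iff it is indefinite (`1 ≤ p_τ ≤ 1 + k`) at every complex embedding. [cite: Landherr1936HermitianForms] -/
theorem isometric_hypModel_one_iff {k : ℕ} (hk : 0 < k) (a : Fin (1 + 1 + k) → L)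
    (ha : ∀ i, IsCMField.complexConj L (a i) = a i) (ha0 : ∀ i, a i ≠ 0) :
    (∃ d : Fin k → L, (∀ i, IsCMField.complexConj L (d i) = d i) ∧ (∀ i, d i ≠ 0) ∧
        ∃ g : GL (Fin (1 + 1 + k)) L,
          ((g : Matrix (Fin (1 + 1 + k)) (Fin (1 + 1 + k)) L).transpose.map (IsCMField.complexConj L)) *
            Matrix.diagonal a * (g : Matrix (Fin (1 + 1 + k)) (Fin (1 + 1 + k)) L) =
              Matrix.diagonal (hypModel L 1 d)) ↔
      ∀ τ : L →+* ℂ, 1 ≤ posCount L τ a ∧ posCount L τ a ≤ 1 + k := by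
  rw [isometric_hypModel_iff L a ha ha0]
  exact ⟨fun h => h.1, fun h => ⟨h, fun h0 => absurd h0 hk.ne'⟩⟩

end Witt

end Landherr

end Literature.NumberTheory.QuadraticForms

end
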